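import Literature.Topology.FourManifolds.KhComplexFaceProofs
import Literature.Topology.FourManifolds.KhResolutionsDichotomyProofs
import Literature.Topology.FourManifolds.RegularProjectionParity
import HarnessLib

/-!
# `d² = 0` for the Khovanov complex of a diagram of a knot: discharge of `khovanovD_comp_khovanovD`

Sibling proof file of `KhComplex.lean` and `KhResolutions.lean` (D-0014: a named fact
`def X : Prop` is discharged as `theorem X_holds : X`). It discharges

* `Literature.Topology.FourManifolds.GaussDiagram.isMergeAt_or_isSplitAt_of_hasGaussDiagram_holds :
  isMergeAt_or_isSplitAt_of_hasGaussDiagram` — **for a Gauss diagram realised by a knot, every edge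
  of the cube of resolutions is a merge or a split** (Viro (2004), §5.2; Bar-Natan (2002), §3.1:
  a planar saddle joins two circles or splits one), from Gauss's parity condition for regular
  projections (`RegularProjectionParity`) and the combinatorial implication parity ⇒ dichotomy
  (`KhResolutionsDichotomyProofs`), both already in the tree; also unbundled as
  `Knot.HasGaussDiagram.isMergeAt_or_isSplitAt`;

* `Literature.Topology.FourManifolds.GaussDiagram.khovanovD_comp_khovanovD_holds :
  G.khovanovD_comp_khovanovD R` — **for a Gauss diagram `G` realised by a knot
  (`Knot.HasGaussDiagram`), the differential of the Khovanov complex of `G` over the Frobenius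
  system `A = R[X]/(X² - hX - t)` squares to zero**, for every commutative ring `R`, every `(h, t)`
  and every homological degree (Khovanov (2000), §4.2, Prop. 8: the cube `V_D` of a plane diagram
  `D` is a commutative `I`-cube, "the commutativity relations follow from the functoriality of
  `F`", the `(1+1)`-dimensional TQFT of `A` on planar cobordisms, §2.3; with the sign assignment of
  §3.3 the total complex `C(D)` is a complex, §3.4; Bar-Natan (2002), §3.2; general `(h, t)`:
  Khovanov (2006), Prop. 4).

The proofs only assemble three results of the tree, which together formalise the printed
argument "planar saddles merge two circles or split one, and the Frobenius algebra relations make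
every face of the cube commute":

1. **planarity ⇒ Gauss's parity condition** (`Knot.RegularProjection.overPos_mod_two_ne_underPos_mod_two`,
   `RegularProjectionParity`; Kauffman (1999), §3.2, Lemma 1, by winding numbers): in the diagram
   read off a regular projection of a knot the two passages through every crossing occupy positions
   of opposite parity;
2. **parity ⇒ merge-or-split** (`GaussDiagram.isMergeAt_or_isSplitAt_of_overPos_mod_two_ne`,
   `KhResolutionsDichotomyProofs`; Viro (2004), §5.2): then every edge `σ → σ[i ↦ 1]` of the cube of
   resolutions is a merge or a split (no one-to-one bifurcation);
3. **merge-or-split ⇒ `d² = 0`** (`GaussDiagram.khovanovD_comp_khovanovD_of_isMergeAt_or_isSplitAt`,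
   `KhComplexFaceProofs`, on top of the abstract face theorem `KhFace.face_comm` of `KhFaces`):
   every two-dimensional face of the cube commutes by the unit, associativity, coassociativity and
   Frobenius relations of `A`, and the Koszul signs `edgeSign` make it anticommute.

## References

* M. Khovanov, *A categorification of the Jones polynomial*, Duke Math. J. 101 (2000) 359–426
  (arXiv:math/9908171), §2.3 (the functor `F`), §3.3–3.4 (skew-commutative cubes and their total
  complexes), §4.2, Prop. 8 (`V_D` is a commutative `I`-cube). [cite: Khovanov2000, §4.2 Prop. 8]
* D. Bar-Natan, *On Khovanov's categorification of the Jones polynomial*, Algebr. Geom. Topol. 2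
  (2002) 337–370, §3.2. [cite: BarNatan2002, §3.2]
* O. Viro, *Khovanov homology, its definitions and ramifications*, Fund. Math. 184 (2004)
  317–342, §5.2. [cite: Viro2004, §5.2]
* L. H. Kauffman, *Virtual knot theory*, European J. Combin. 20 (1999) 663–690, §3.2, Lemma 1.
  [cite: Kauffman1999, §3.2 Lemma 1]

## Design notes

No definition and no named fact is introduced (D-0026). The realisability hypothesis
`hG : ∃ K, K.HasGaussDiagram G` of both facts is consumed here and only here: it yields a regular
projection `P` with `P.diagram = G`, to which (1) applies.
-/

noncomputable section

namespace Literature.Topology.FourManifolds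

namespace Knot.HasGaussDiagram

/-- **Gauss's parity condition for a realised diagram**: if the knot `K` has Gauss diagram `G`,
the two passages through every crossing of `G` occupy positions of opposite parity. This is
`Knot.RegularProjection.overPos_mod_two_ne_underPos_mod_two` (`RegularProjectionParity`) read
through `HasGaussDiagram`. Kauffman (1999), §3.2, Lemma 1 (a planar Gauss code is evenly
intersticed); C. F. Gauss, *Werke* VIII, pp. 272, 282–286. [cite: Kauffman1999, §3.2 Lemma 1] -/
theorem overPos_mod_two_ne_underPos_mod_two {K : Knot} {G : GaussDiagram}
    (hK : K.HasGaussDiagram G) (j : Fin G.n) :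
    (G.overPos j).val % 2 ≠ (G.underPos j).val % 2 := by
  obtain ⟨P, rfl⟩ := hK
  exact P.overPos_mod_two_ne_underPos_mod_two j

/-- **Merge-or-split for diagrams of knots**, unbundled: if the knot `K` has Gauss diagram `G`,
every edge `σ → σ[i ↦ 1]` of the cube of resolutions of `G` at a `0`-smoothed chord `i` is a
merge or a split (no one-to-one bifurcation). Gauss's parity condition
(`overPos_mod_two_ne_underPos_mod_two`) and `GaussDiagram.isMergeAt_or_isSplitAt_of_overPos_mod_two_ne`
(`KhResolutionsDichotomyProofs`). Viro (2004), §5.2 (adjacent states of a planar diagram differ by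
a Morse modification joining two circles or splitting one); Bar-Natan (2002), §3.1.
[cite: Viro2004, §5.2] -/
theorem isMergeAt_or_isSplitAt {K : Knot} {G : GaussDiagram} (hK : K.HasGaussDiagram G)
    {σ : G.State} {i : Fin G.n} (hσ : σ i = false) : G.IsMergeAt σ i ∨ G.IsSplitAt σ i :=
  GaussDiagram.isMergeAt_or_isSplitAt_of_overPos_mod_two_ne
    (overPos_mod_two_ne_underPos_mod_two hK) hσ

end Knot.HasGaussDiagram

namespace GaussDiagram

variable {G : GaussDiagram}

/-- **Merge-or-split dichotomy for diagrams of knots** — discharge of the named fact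
`isMergeAt_or_isSplitAt_of_hasGaussDiagram` of `KhResolutions`: if the Gauss diagram `G` is
realised by a knot, then at every `0`-smoothed chord of every state the flip `0 → 1` is a merge
or a split. Proof: realisability gives Gauss's parity condition
(`Knot.RegularProjection.overPos_mod_two_ne_underPos_mod_two`, `RegularProjectionParity`, by
winding numbers), and the parity condition gives the dichotomy
(`isMergeAt_or_isSplitAt_of_overPos_mod_two_ne`, `KhResolutionsDichotomyProofs`). Viro (2004),
§5.2; Bar-Natan (2002), §3.1; Khovanov (2000), §4.2. [cite: Viro2004, §5.2] -/
theorem isMergeAt_or_isSplitAt_of_hasGaussDiagram_holds :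
    isMergeAt_or_isSplitAt_of_hasGaussDiagram (G := G) :=
  fun hG hσ ↦ hG.elim fun _ hK ↦ Knot.HasGaussDiagram.isMergeAt_or_isSplitAt hK hσ

variable (G) (R : Type) [CommRing R]

/-- **`d² = 0` for the Khovanov complex of a diagram of a knot** — discharge of the named fact
`khovanovD_comp_khovanovD` of `KhComplex`: if the Gauss diagram `G` is realised by a knot, then
`khovanovD R h t (i + 1) (i + 2) ∘ khovanovD R h t i (i + 1) = 0` over `A = R[X]/(X² - hX - t)` for
every commutative ring `R`, every `(h, t)` and every `i`. Khovanov (2000), §4.2, Prop. 8 (the cube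
of resolutions `V_D` of a plane diagram is commutative, by functoriality of the TQFT `F` of §2.3 on
planar cobordisms) with §3.3–3.4 (signs; `C(D)` is a complex); Bar-Natan (2002), §3.2; Khovanov
(2006), Prop. 4 for general `(h, t)`. Proof: realisability gives Gauss's parity condition
(`RegularProjectionParity`), hence merge-or-split at every edge
(`isMergeAt_or_isSplitAt_of_hasGaussDiagram_holds`), hence `d² = 0` by the face analysis
`khovanovD_comp_khovanovD_of_dichotomy` (`KhComplexFaceProofs`).
[cite: Khovanov2000, §4.2 Prop. 8] -/
theorem khovanovD_comp_khovanovD_holds : G.khovanovD_comp_khovanovD R :=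
  khovanovD_comp_khovanovD_of_dichotomy G R (@isMergeAt_or_isSplitAt_of_hasGaussDiagram_holds G)

end GaussDiagram

end Literature.Topology.FourManifolds
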